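import Mathlib
import HarnessLib
import Summits.HodgeConjecture.HodgeConjecture.Theses.EndoscopicMiddleDegree
import Literature.AlgebraicGeometry.ShimuraVarieties.SpecialCycleClasses
import Literature.AlgebraicGeometry.HodgeTheory.HodgeConjecture

/-!
# Sketch — crux `SectorComplement` (stmt-HodgeConjecture-14353), ideator 3, round 1

Typed first lemmas for the two crux idea cards of this seat.

* Card `regular-weight-character-hosts`: the in-family enlargement of the sector.  `AllBallHC p₀`
  (HC for every compact simple-unitary ball quotient of dimension `p ≥ p₀`, every degree),
  `thetaSpan` / `ThetaSpanAll` (the heart `MiddleThetaSpan` written for every `(p, k)`),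
  the proved glue `allBallHC_of_thetaSpanAll` (induction on the degree; no hard Lefschetz, no
  Cor. 62), the consistency `middleThetaSpan_of_thetaSpanAll`, and the RE-CUT of the frame:
  `sectorComplement_of_ballComplement : BallComplement 3 → … → SectorComplement` with
  `BallComplement p₀ := AllBallHC p₀ → HodgeConjecture` the honest residual.
* Card `fixed-part-kuga-descent`: the pure-logic shape of the descent step
  (`descent_of_lift`), over abstract restriction data; the geometric inputs are the tree's named
  facts `deligne_globalInvariantCycles`, `charlesSchnell_hodgeClass_of_flat` (not restated).
-/

namespace Summit.HodgeConjecture.HodgeConjecture.Cruxes.SectorComplement.IdeatorThree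

open Literature.AlgebraicGeometry Literature.AlgebraicGeometry.HodgeTheory
  Literature.AlgebraicGeometry.ShimuraVarieties Literature.AlgebraicGeometry.Motives
  Literature.AlgebraicTopology.SingularHomology
open Summit.HodgeConjecture.HodgeConjecture.Theses.EndoscopicMiddleDegree

/-- **HC for compact simple-unitary ball quotients of dimension `≥ p₀`, all degrees.** -/
def AllBallHC (p₀ : ℕ) : Prop :=
  ∀ (p : ℕ) (X : SchemeOver ℂ), p₀ ≤ p → Nonempty (UnitaryBallQuotientDatum p X) →
    ∀ (k : ℕ) (c : complexBetti X (2 * k)), IsRationalClass c → IsOfHodgeType p X (2 * k) k k c →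
      c ∈ algebraicClasses X k

/-- The **re-cut frame**: HC off the WHOLE family of compact simple-unitary ball quotients of
dimension `≥ p₀` (still implied only by HC itself; the honest residual of `SectorComplement`). -/
def BallComplement (p₀ : ℕ) : Prop := AllBallHC p₀ → _root_.HodgeConjecture

/-- The **theta span** in degree `2(k+1)` of a datum `D` (dimension `p`): special cycles of
codimension `k+1` ⊔ (special cycles of codimension `k`) ∪ Alg¹ ⊔ (rational Hodge `(k,k)`) ∪ Alg¹ —
the three summands of the route's `MiddleThetaSpan`, for arbitrary `(p, k)`. -/
noncomputable def thetaSpan {p : ℕ} {X : SchemeOver ℂ} (D : UnitaryBallQuotientDatum p X) (k : ℕ) :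
    Submodule ℂ (complexBetti X (2 * (k + 1))) :=
  specialCycleClasses D (k + 1) ⊔
    Submodule.span ℂ {z : complexBetti X (2 * (k + 1)) | ∃ s ∈ specialCycleClasses D k,
      ∃ d ∈ algebraicClasses X 1, z = cupProduct (two_mul_add_two_mul k 1) s d} ⊔
    Submodule.span ℂ {z : complexBetti X (2 * (k + 1)) | ∃ a : complexBetti X (2 * k),
      IsRationalClass a ∧ IsOfHodgeType p X (2 * k) k k a ∧
        ∃ d ∈ algebraicClasses X 1, z = cupProduct (two_mul_add_two_mul k 1) a d}

/-- **`ThetaSpanAll`** (the heart for every `(p, k)`, `p ≥ 3`): every rational Hodge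
`(k+1, k+1)`-class of a compact simple-unitary ball quotient lies in the theta span. -/
def ThetaSpanAll : Prop :=
  ∀ (p : ℕ) (X : SchemeOver ℂ) (D : UnitaryBallQuotientDatum p X), 3 ≤ p →
    ∀ (k : ℕ) (c : complexBetti X (2 * (k + 1))), IsRationalClass c →
      IsOfHodgeType p X (2 * (k + 1)) (k + 1) (k + 1) c → c ∈ thetaSpan D k

/-- Consistency: `ThetaSpanAll` at `p = 2(m+1)`, `k = m` is literally the route's heart. -/
theorem middleThetaSpan_of_thetaSpanAll (h : ThetaSpanAll) : MiddleThetaSpan := by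
  intro m X D h1 _h2 c hc hh
  exact h (2 * (m + 1)) X D (by omega) m c hc hh

/-- The theta span consists of algebraic classes as soon as cup products of algebraic classes are
algebraic and HC holds in degree `2k` on `X` (special cycle classes are algebraic:
`specialCycleClasses_le_algebraicClasses`). -/
theorem thetaSpan_le_algebraicClasses (hcup : CupProductAlgebraic) {p : ℕ} {X : SchemeOver ℂ}
    (D : UnitaryBallQuotientDatum p X) (k : ℕ)
    (hk : ∀ a : complexBetti X (2 * k), IsRationalClass a → IsOfHodgeType p X (2 * k) k k a →
      a ∈ algebraicClasses X k) :
    thetaSpan D k ≤ algebraicClasses X (k + 1) := by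
  refine sup_le (sup_le (specialCycleClasses_le_algebraicClasses D (k + 1)) ?_) ?_
  · refine Submodule.span_le.2 ?_
    rintro z ⟨s, hs, d, hd, rfl⟩
    exact hcup D.isSmoothProjective k 1 s d (specialCycleClasses_le_algebraicClasses D k hs) hd
  · refine Submodule.span_le.2 ?_
    rintro z ⟨a, ha, hha, d, hd, rfl⟩
    exact hcup D.isSmoothProjective k 1 a d (hk a ha hha) hd

/-- **Glue (proved): `CupProductAlgebraic → ThetaSpanAll → AllBallHC 3`**, by induction on the
degree; degree `0` is `algebraicClasses_zero`. No hard Lefschetz, no rationality of `H^{a,a}`. -/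
theorem allBallHC_of_thetaSpanAll (hcup : CupProductAlgebraic) (hθ : ThetaSpanAll) :
    AllBallHC 3 := by
  intro p X hp hD k
  obtain ⟨D⟩ := hD
  induction k with
  | zero =>
    intro c _ _
    rw [algebraicClasses_zero]
    exact Submodule.mem_top
  | succ k ih =>
    intro c hc hh
    exact thetaSpan_le_algebraicClasses hcup D k ih (hθ p X D hp k c hc hh)

/-- `AllBallHC 3` contains the sector target `MiddleDegreeStep` (its conclusion, hypothesis unused). -/
theorem middleDegreeStep_of_allBallHC (h : AllBallHC 3) : MiddleDegreeStep := by
  intro m X h1 _h2 hD _hyp c hc hh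
  exact h (2 * (m + 1)) X (by omega) hD (m + 1) c hc hh

/-- **Re-cut of the frame (proved):** `SectorComplement` follows from the in-family statement
`ThetaSpanAll`, the known `CupProductAlgebraic`, and the honest residual `BallComplement 3`. -/
theorem sectorComplement_of_ballComplement (hB : BallComplement 3) (hcup : CupProductAlgebraic)
    (hθ : ThetaSpanAll) : SectorComplement :=
  fun _ ↦ hB (allBallHC_of_thetaSpanAll hcup hθ)

/-- Conversely the residual is implied by the crux (so the re-cut loses nothing). -/
theorem ballComplement_of_sectorComplement (hS : SectorComplement) : BallComplement 3 :=
  fun h ↦ hS (middleDegreeStep_of_allBallHC h)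

/-! ### Card `fixed-part-kuga-descent`: the logic of the descent step -/

/-- **Descent of HC along a restriction map with Hodge lifts** (pure logic): if `r : H_tot → H_fib`
maps algebraic classes to algebraic classes and every class of `Hdg_fib` is the image of a class of
`Hdg_tot` (global invariant cycle theorem + semisimplicity over a COMPACT base), then
`Hdg_tot ⊆ Alg_tot` gives `Hdg_fib ⊆ Alg_fib`. -/
theorem descent_of_lift {V W : Type*} [AddCommGroup V] [Module ℂ V] [AddCommGroup W] [Module ℂ W]
    (r : V →ₗ[ℂ] W) (HdgV AlgV : Submodule ℂ V) (HdgW AlgW : Submodule ℂ W)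
    (hr : AlgV.map r ≤ AlgW) (hlift : HdgW ≤ HdgV.map r) (hHC : HdgV ≤ AlgV) : HdgW ≤ AlgW :=
  hlift.trans ((Submodule.map_mono hHC).trans hr)

end Summit.HodgeConjecture.HodgeConjecture.Cruxes.SectorComplement.IdeatorThree
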